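import Mathlib

/-!
# `MatrixDescartes` — the JUNCTION CEILING, typed (val-idea-5 g2 deliverable (B)), Theorems-side port 1/3: DEFINITIONS
# (`posD`, `posM`, `pencil`, `junction`; `SeamPlusOne`, `NonsingularJunctionAdditive`, `SeamCeiling`, `KernelDefiniteJunction`,
# `KernelNonsilentJunction`)

HONEST FRAMING (port).  Definitions-only companion (D-0009) of the port of the crux workfile
`Cruxes/MatrixDescartes/Lines/junction_ceiling.lean` (val-idea-5 g2, deliverable (B) requested by director-valiant g10; sha16
ec3c5bea67a7dcd8, 679 l., ZERO sorries since its one stub `stub_kernelDefiniteJunction` became the tree theorem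
`JunctionCeiling.kernelDefiniteJunction` (val-width-18050-kj1 g0, p604951; wired 2026-08-28 @48ff5251ab7a)) into `Theorems/` (porter
val-port-4 g1, val-lit merged desk g11 RULING #233 (b), menu (i)): this file = the workfile's §1 (vocabulary), §2 (the typed ceilings)
and §8 (`KernelNonsilentJunction`), texts VERBATIM in the namespace of kj1's theorem; the theorems are in `…JunctionCeilingSeam` (2/3:
`KernelDefiniteJunction m` and `NonsingularJunctionAdditive m` for all `m` BY NAME, `¬ SeamPlusOne 2`) and `…JunctionCeilingSeamB`
(3/3: `¬ SeamCeiling 2 1`, the leak example).  NOTHING is asserted here: `SeamPlusOne 2` and `SeamCeiling 2 1` are REFUTED downstream,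
`SeamCeiling m m` is an OPEN guess of the workfile (neither stubbed nor asserted anywhere), `KernelNonsilentJunction` is the workfile's OPEN
sharpening; `KernelDefiniteJunction` / `NonsingularJunctionAdditive` are proved downstream by name.  `pencil` here is indexed by an arbitrary
`Fintype` (the junction is `Sum`-indexed), unlike the `Fin K`-indexed `…FiniteSector.pencil`; both unfold to the census expression
`∑ l, X ^ (d l) • (S l).map C`.  Crux `Summit.ValiantsHypothesis.ValiantsHypothesis.Theses.LacunarySymmetroid.MatrixDescartes`
(stmt-ValiantsHypothesis-18050): nothing in this port bears on it, on `DoorA26`, on Conjecture B or on VP ≠ VNP.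
[folklore] (root-count vocabulary; the typed sentences are the cell's, recorded as propositions).  The workfile's header follows verbatim.

# Deliverable (B), val-idea-5 gen 2 — the JUNCTION CEILING: «does a graft / junction add at most ONE real root over the
# patchwork (additive) count?»  Typed three ways; the literal «+1» is REFUTED in the kernel (m = 2), the nonsingular core is
# the ONE structural stub.

HONEST FRAMING.  Ideator sketch (D-0148 (a) seat val-idea-5 g2, lens «symbolic-evo on the census»), crux `MatrixDescartes`
(stmt-ValiantsHypothesis-18050); requested by director-valiant g10 (bus l.9633 (d)) as the upgrade path of the LAW-tier line
«unit-subtropical» (`ζ_sym ≤ T_gen + 1`): «TYPE the junction lemma ‹a graft adds ≤ 1 real root over the patchwork (tropical) count›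
as ONE kernel statement over the tree's graft/patchwork vocabulary, with its cheapest falsifier».  NOT registered, no `skeleton check`.
Nothing here is a theorem about `MatrixDescartes`, `DoorA26`, Conjecture B or VP ≠ VNP; the one `sorry` is the structural stub
`stub_kernelDefiniteJunction`; the refutations `not_seamPlusOne_two`, `not_seamCeiling_two_one`, the leak example and the reduction
`nonsingularJunctionAdditive_of_kernelDefinite` are sorry-free.

THE OBJECT (the tree's junction vocabulary, `Census.Chain.exists_alternating_junction`).  `P = ∑ X^{d l} • S l` (`K₁+1` letters,
strictly increasing support, TOP letter `J = S last` at exponent `a = d last`), `Q = ∑ X^{e l} • T l` (`K₂+1` letters, BOTTOM letter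
`T 0 = J` at exponent `b = e 0`), and the junction pencil at scale `Λ`:
  `H_Λ = P + ∑_{l ≥ 1} Λ^{-(e l − b)} X^{a + e l − b} • T l`   (`K₁ + K₂ + 1` letters; the kernel's `exists_alternating_junction` shape,
indexed here by `Fin (K₁+1) ⊕ Fin K₂` instead of `Fin.append`).  The kernel proves the FLOOR `ζ(H_Λ) ≥ ζ_alt(P) + ζ_alt(Q)` (eventually
in `Λ`) and drops the seam point.  «Patchwork count» := the additive count `ζ•(P) + ζ•(Q)` (positive roots WITH multiplicity, so that
root splitting is not miscounted); the question is the CEILING: how many roots can the SEAM (and the far ends) add?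

RESULTS OF THIS FILE.
* `SeamPlusOne m` — the director's sentence typed literally: for a SINGULAR nonzero junction letter (`J ≠ 0`, `det J = 0`; corank one
  when `m = 2`) the junction has eventually `ζ(H_Λ) ≤ ζ•(P) + ζ•(Q) + 1`.  **REFUTED at `m = 2`: `not_seamPlusOne_two`** (kernel, sorry-free):
  `P = diag(0,1) + [[0,1],[1,0]]·X³ + diag(1,0)·X⁴` (`det P = X⁴ − X⁶`, one positive root), `Q = diag(1,0) + [[0,−1],[−1,0]]·X + diag(0,1)·X³`
  (`det Q = X³ − X²`, one positive root), and `det H_Λ = X⁴ − X⁶ + 2Λ⁻¹X⁸ − Λ⁻²X¹⁰ + Λ⁻³X¹¹` alternates `+,−,+,−,+` at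
  `½, 2, √Λ, 2√Λ, 2Λ` for every `Λ ≥ 16`: FOUR roots = 1 + 1 + 2.  Mechanism: at a corank-one seam `det H ≈ x^a·J₁₁·H₂₂ − H₁₂²`; the
  square `H₁₂² = (x³ − Λ⁻¹x⁵)²` has a DOUBLE zero inside the seam (`x₀ = √Λ`) which the lower-order positive term `x^a H₂₂` opens into
  TWO simple zeros — the symmetric-design «tied Leibniz terms» phenomenon (Li–Wang / the census's `(2,4): 9 > 8`) in its smallest instance.
  So «+1 per graft/junction» is NOT a mechanism: a corank-one seam carries up to `m = 2` roots (exact Sturm search over 8 000 random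
  `2 × 2` junctions, `seam/search_excess2.py`: maximal seam excess 2, attained; never 3).
* `KernelDefiniteJunction m` — **the ONE structural stub** (`stub_kernelDefiniteJunction`, non-law, plausibly TRUE): far ends nonsingular and
  the two SEAM NEIGHBOURS (letter of `P` just below `J`, letter of `Q` just above it) definite on `ker J` («non-silent seam») ⇒ eventually
  `ζ(H_Λ) ≤ ζ•(P) + ζ•(Q) + corank J`.  Corank one = the director's sentence made true («a graft through a corank-one letter adds ≤ 1 root over
  the patchwork count, unless the seam is silent»); rank `m` = ADDITIVITY, derived sorry-free as `NonsingularJunctionAdditive m`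
  (`nonsingularJunctionAdditive_of_kernelDefinite`): the kernel's junction FLOOR through nonsingular letters is also the CEILING — scale-separated
  recombination of nonsingular-ended certificates is EXACTLY additive (all 4 seeds of the `m = 2` register, `T14 G18 C22 G25`, have integer
  letters of exact rank 2 with DEFINITE end letters, so `28@(2,9) = 14 + 14` is the ceiling of `T14 ⋈ T14♯` in the limit, not just its floor).
  DATA (cheapest falsifier, run: `seam/search_excess4.py`, 12 155 random `2 × 2` junctions, entries in {−2..2}, ≤ 4+4 letters, Λ = 2²⁴, `P•,Q•`
  by exact Sturm with multiplicity, `ζ(H)` by sign alternations on a 2^{1/6}-grid): max excess `ζ(H) − P• − Q•` by class —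
  rank J = 2, ends nonsingular: **0** · rank J = 2, a rank-one far end: 1 (leak) · corank 1, ends nonsingular, seam non-silent: **1** ·
  corank 1, one silent side: 1 · corank 1, BOTH sides silent: **2** (the tie) · corank 1 with singular ends: 1.  No class exceeds `corank + #leaky ends`
  except the doubly-silent seam (= the refuting examples below), and nothing exceeds 2.
* `zeroLeak_example` (kernel, sorry-free): the far-end hypothesis is needed — nonsingular `J = diag(1,−1)` but a RANK-ONE bottom letter
  `[[1,1],[1,1]]`: `det P = −X⁶` (no positive root), `det Q = X − 1` (one), and `det H_Λ = −X⁶ + Λ⁻¹X⁴ + Λ⁻¹X⁷` has TWO positive roots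
  (one LEAKS out of `x = 0` at `x ≈ Λ^{-1/2}`).
* `SeamCeiling m c` — the ceiling with nonsingular far ends and ARBITRARY junction letter: **`SeamCeiling 2 1` REFUTED in the kernel**
  (`not_seamCeiling_two_one`: same seam, far ends `diag(1/8,1)` / `diag(1/8,−1)`, THREE roots = 1 + 0 + 2); conjecture `SeamCeiling m m`
  (m = 2: random search never exceeds 2) — OPEN, not stubbed (it would be a law-tier item; only the additive core is stubbed).

WHAT IT SAYS ABOUT THE LAWS (honest).  (i) The `+1` of «unit-subtropical» (`ζ_sym ≤ T_gen + 1`) is NOT a per-junction constant; in the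
scale-separated idealisation every extra root sits at a SINGULAR (in the census: near-singular, κ ~ 10⁻⁹…10⁻¹³ — desk R2391) letter: seams
carry ≤ m (m = 2 data), rank-one far ends leak ≤ 1 each; nonsingular recombination is additive.  This is the Λ → ∞ shadow of the cell's
located «RANK-ONE WINDOW LAW» and says the law-deciding objects are the SEEDS, not the junctions — consistent with both PASS-WITH-PRICE
verdicts (instruments = seed hunt / exact T_gen(3,5)).  (ii) NEW FLOOR TOOLS the kernel's Chain toolbox lacks, each a typed eventual
construction: DEFECTIVE JUNCTION (+2 at m = 2 through a corank-one letter whose neighbours have zero kernel-compression and opposite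
off-diagonal signs — `not_seamPlusOne_two` is its smallest certificate) and LEAKY END (+1 per rank-one far-end letter).  PREDICTIONS they
put on the row law «eleven-thirds» (`⌊11(K−1)/3⌋`, junction-closed under ADDITIVE junctions only): a (2,5) pencil with 13 roots, a
positive-defective top AND leaky ends would give `13 + 13 + 2 + 2 = 30 > 29` at (2,9) — so PRED-e11/3 implies «no 13-root (2,5) pencil is
defective-and-leaky», «no 14-root (2,5) pencil has a rank-one end or a positive-defective top» (each alone gives 29 or 30); the register's
seeds are all rank-2-ended (checked from the kernel data), consistent.  Cheapest experiment (engines, not this seat): re-run the (2,5)/(2,6)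
seed hunts CONSTRAINED to a rank-one end letter / a defective top and read the junction bonus.  (iii) VP ≠ VNP is not moved.
[folklore] throughout (continuity of roots, Descartes' rule with multiplicity = Mathlib `roots_countP_pos_le_signVariations`).
-/

-- `Summit.ValiantsHypothesis.ValiantsHypothesis.…` repeats a component by the D-0017 layout
-- (single-conjunct summit), which the `dupNamespace` linter flags; the name is mandated.
set_option linter.dupNamespace false
set_option autoImplicit false

namespace Summit.ValiantsHypothesis.ValiantsHypothesis.Theorems.LacunarySymmetroidMatrixDescartes.JunctionCeiling

open Polynomial Finset Filter
open scoped BigOperators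

variable {m : ℕ}

/-! ## 1. Vocabulary (abbreviations; `pencil` is the tree's `∑ X^{d l} • (S l).map C`, `junction` the kernel's `H_Λ` re-indexed by a Sum type) -/

/-- distinct positive roots (census currency). -/
noncomputable def posD (p : ℝ[X]) : ℕ := (p.roots.toFinset.filter (fun t => 0 < t)).card

/-- positive roots counted WITH multiplicity (the additive «patchwork» currency of a block). -/
noncomputable def posM (p : ℝ[X]) : ℕ := p.roots.countP (fun t => 0 < t)

/-- the lacunary matrix pencil `∑ X^{d l} • S l` over any finite index type (the junction below is `Sum`-indexed).  NOT the
`Fin K`-indexed `…Theorems.LacunarySymmetroidMatrixDescartes.FiniteSector.pencil` of `…FiniteSectorDefs` — different namespace and index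
type, same census expression `∑ l, X ^ (d l) • (S l).map C`. [folklore] -/
noncomputable def pencil {ι : Type*} [Fintype ι] (d : ι → ℕ) (S : ι → Matrix (Fin m) (Fin m) ℝ) :
    Matrix (Fin m) (Fin m) ℝ[X] :=
  ∑ l, (X : ℝ[X]) ^ d l • (S l).map C

/-- the kernel's junction pencil `H_Λ` of `P = pencil d S` (`K₁+1` letters, top letter `S last`) and `Q = pencil e T` (`K₂+1` letters,
bottom letter `T 0`, meant to equal `S last`): `P` kept verbatim, the letters `T l.succ` appended at exponents `d last + (e l.succ − e 0)`
with coefficients `Λ^{-(e l.succ − e 0)}` (shape of `Census.Chain.exists_alternating_junction`). -/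
noncomputable def junction (K₁ K₂ : ℕ) (d : Fin (K₁ + 1) → ℕ) (S : Fin (K₁ + 1) → Matrix (Fin m) (Fin m) ℝ)
    (e : Fin (K₂ + 1) → ℕ) (T : Fin (K₂ + 1) → Matrix (Fin m) (Fin m) ℝ) (Λ : ℝ) : Matrix (Fin m) (Fin m) ℝ[X] :=
  pencil (Sum.elim d (fun l : Fin K₂ => d (Fin.last K₁) + (e l.succ - e 0)))
    (Sum.elim S (fun l : Fin K₂ => (Λ⁻¹) ^ (e l.succ - e 0) • T l.succ))

/-! ## 2. The three typed ceilings -/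

/-- **«a junction through a singular letter adds at most ONE root over the additive count»** — the director's sentence, typed.
Recorded statement, NOT asserted; REFUTED at `m = 2` in `…JunctionCeilingSeam` (`not_seamPlusOne_two`). -/
def SeamPlusOne (m : ℕ) : Prop :=
  ∀ (K₁ K₂ : ℕ) (d : Fin (K₁ + 1) → ℕ) (S : Fin (K₁ + 1) → Matrix (Fin m) (Fin m) ℝ)
    (e : Fin (K₂ + 1) → ℕ) (T : Fin (K₂ + 1) → Matrix (Fin m) (Fin m) ℝ),
    StrictMono d → StrictMono e → (∀ l, (S l).IsSymm) → (∀ l, (T l).IsSymm) →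
    T 0 = S (Fin.last K₁) → S (Fin.last K₁) ≠ 0 → (S (Fin.last K₁)).det = 0 →
    (pencil d S).det ≠ 0 → (pencil e T).det ≠ 0 →
    ∀ᶠ Λ : ℝ in atTop,
      posD (junction K₁ K₂ d S e T Λ).det ≤ posM (pencil d S).det + posM (pencil e T).det + 1

/-- **NONSINGULAR JUNCTIONS ARE ADDITIVE** (the structural core; the ONE stub): junction letter and both far-end letters nonsingular
⇒ eventually `ζ(H_Λ) ≤ ζ•(P) + ζ•(Q)`.  Recorded statement, NOT asserted here; PROVED for all `m` BY NAME in `…JunctionCeilingSeam`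
(`nonsingularJunctionAdditive_holds`, from kj1's tree theorem `JunctionCeiling.kernelDefiniteJunction`, p604951). -/
def NonsingularJunctionAdditive (m : ℕ) : Prop :=
  ∀ (K₁ K₂ : ℕ) (d : Fin (K₁ + 1) → ℕ) (S : Fin (K₁ + 1) → Matrix (Fin m) (Fin m) ℝ)
    (e : Fin (K₂ + 1) → ℕ) (T : Fin (K₂ + 1) → Matrix (Fin m) (Fin m) ℝ),
    StrictMono d → StrictMono e → (∀ l, (S l).IsSymm) → (∀ l, (T l).IsSymm) →
    T 0 = S (Fin.last K₁) → (S 0).det ≠ 0 → (S (Fin.last K₁)).det ≠ 0 → (T (Fin.last K₂)).det ≠ 0 →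
    ∀ᶠ Λ : ℝ in atTop,
      posD (junction K₁ K₂ d S e T Λ).det ≤ posM (pencil d S).det + posM (pencil e T).det

/-- **SEAM CEILING with constant `c`**: nonsingular far ends, ARBITRARY junction letter.  Recorded statement, NOT asserted: `SeamCeiling 2 1`
is REFUTED in the kernel (`…JunctionCeilingSeamB`, `not_seamCeiling_two_one`); `SeamCeiling m m` is the workfile's OPEN guess (neither stubbed
nor asserted anywhere). -/
def SeamCeiling (m c : ℕ) : Prop :=
  ∀ (K₁ K₂ : ℕ) (d : Fin (K₁ + 1) → ℕ) (S : Fin (K₁ + 1) → Matrix (Fin m) (Fin m) ℝ)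
    (e : Fin (K₂ + 1) → ℕ) (T : Fin (K₂ + 1) → Matrix (Fin m) (Fin m) ℝ),
    StrictMono d → StrictMono e → (∀ l, (S l).IsSymm) → (∀ l, (T l).IsSymm) →
    T 0 = S (Fin.last K₁) → (S 0).det ≠ 0 → (T (Fin.last K₂)).det ≠ 0 →
    (pencil d S).det ≠ 0 → (pencil e T).det ≠ 0 →
    ∀ᶠ Λ : ℝ in atTop,
      posD (junction K₁ K₂ d S e T Λ).det ≤ posM (pencil d S).det + posM (pencil e T).det + c

/-- **KERNEL-DEFINITE JUNCTION LAW** — the director's «+1», typed so that it is (plausibly) TRUE: a junction adds at most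
`corank J = m − rank J` roots over the additive count PROVIDED the two seam neighbours (the letter of `P` just below the junction letter and
the letter of `Q` just above it) are DEFINITE ON `ker J` («non-silent seam») and the far ends are nonsingular.  Corank one ⇒ exactly the
sentence «a graft through a corank-one letter adds ≤ 1 root over the patchwork count»; rank `m` ⇒ additivity.  The refuted examples of §4/§4b
are SILENT seams (both neighbours `[[0,±1],[±1,0]]` vanish on `ker diag(1,0)`), which is exactly where the symmetric-design tie lives.
Mechanism (why it should hold): on the seam window `x^{-a}H_Λ = J + x^{-(a-d')}S' + Λ^{-w₁}x^{w₁}T₁ + (lower order)`; the Schur complement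
onto `ker J` is `A' x^{-(a-d')} + B' μ(x) + …` with `A' = S'|_{ker J}`, `B' = T₁|_{ker J}` nonsingular `c × c` forms, whose determinant
`det(A' + μB')` has ≤ c positive roots in `μ`, simple crossings surviving perturbation by Rolle; `0`, `P`-window, `Q`-window and `∞` are
controlled by `det S₀ ≠ 0`, Hurwitz/Rolle root continuity (multiplicity = the currency `posM`), and `det T_last ≠ 0`.
Recorded statement, NOT asserted here; PROVED for all `m` BY NAME: the tree theorem `JunctionCeiling.kernelDefiniteJunction`
(val-width-18050-kj1 g0, p604951, `Theorems/LacunarySymmetroidMatrixDescartesKernelDefiniteJunction.lean`, vocabulary unfolded) is this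
proposition, re-folded as `kernelDefiniteJunction_holds` in `…JunctionCeilingSeam`. [folklore] -/
def KernelDefiniteJunction (m : ℕ) : Prop :=
  ∀ (K₁ K₂ : ℕ) (d : Fin (K₁ + 1) → ℕ) (S : Fin (K₁ + 1) → Matrix (Fin m) (Fin m) ℝ)
    (e : Fin (K₂ + 1) → ℕ) (T : Fin (K₂ + 1) → Matrix (Fin m) (Fin m) ℝ),
    StrictMono d → StrictMono e → (∀ l, (S l).IsSymm) → (∀ l, (T l).IsSymm) →
    T 0 = S (Fin.last K₁) → (S 0).det ≠ 0 → (T (Fin.last K₂)).det ≠ 0 →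
    (∀ v : Fin m → ℝ, v ≠ 0 → (S (Fin.last K₁)).mulVec v = 0 →
        (∀ l : Fin (K₁ + 1), l < Fin.last K₁ → (∀ l', l' < Fin.last K₁ → l' ≤ l) → v ⬝ᵥ (S l).mulVec v ≠ 0) ∧
        (∀ l : Fin (K₂ + 1), 0 < l → (∀ l', 0 < l' → l ≤ l') → v ⬝ᵥ (T l).mulVec v ≠ 0)) →
    ∀ᶠ Λ : ℝ in atTop,
      posD (junction K₁ K₂ d S e T Λ).det ≤
        posM (pencil d S).det + posM (pencil e T).det + (m - (S (Fin.last K₁)).rank)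

/-! ## 8. (v2 appendix — information for the width seat, no new `sorry`) NON-SILENT far ends

DATA (HOME `lawfit/seam/search_excess5.py`, outputs r31–r33: 10 597 random 2×2 junctions with NONSINGULAR junction letter, far ends classified
nonsingular / rank-one NON-silent / rank-one SILENT / zero; critic val-idea-crit-1's mutation (a) on its own exact code likewise): a
super-additive root at a FAR END of `H_Λ` occurs only when the end letter is rank-deficient AND its inward neighbour is SILENT on the end
letter's kernel — the `Leak` example of §7 has `uᵀ J₂ u = 0` for `u ∈ ker V`.  Mechanism: if `E = S 0` has kernel `V ≠ 0` and the next letter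
`N = S 1` is non-degenerate on `V`, then near `x → 0` the small eigenvalues of `P(x)` are `≍ x^(d 1)·(N|V)` while the appended letters of `H_Λ`
are `O(Λ^{-1} x^(a+1))` at matrix level, uniformly dominated on `(0, 1]` as `Λ → ∞` — no root is created; with a silent `N` the degeneracy is
resolved by the appended letters themselves and a root appears at `x ≍ Λ^{-1/2}`.  Hence the far-end hypotheses `(S 0).det ≠ 0`,
`(T (Fin.last K₂)).det ≠ 0` of `KernelDefiniteJunction` are expected to weaken to NON-SILENCE; `KernelNonsilentJunction` below is that
sharpening (a STRONGER statement) and the booked stub follows from it by the kernel-checked monotonicity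
`kernelDefiniteJunction_of_nonsilent`.  The seat may prove either; nothing here changes the booked stub or its PRED of record. -/

/-- `KernelDefiniteJunction` with the far ends NON-SILENT instead of nonsingular: every nonzero kernel vector of the bottom letter `S 0`
sees the next letter of `P` (`v ⬝ᵥ (S l).mulVec v ≠ 0` for the least `l > 0`), and every nonzero kernel vector of the top letter
`T (Fin.last K₂)` sees the previous letter of `Q` (the greatest `l < Fin.last K₂`).  For nonsingular ends both hypotheses are vacuous.
Conclusion unchanged: eventually in `Λ`, `ζ(H_Λ) ≤ P• + Q• + corank J`.  Recorded statement (the workfile's OPEN sharpening), NOT asserted;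
it implies `KernelDefiniteJunction` (`kernelDefiniteJunction_of_nonsilent` in `…JunctionCeilingSeam`). -/
def KernelNonsilentJunction (m : ℕ) : Prop :=
  ∀ (K₁ K₂ : ℕ) (d : Fin (K₁ + 1) → ℕ) (S : Fin (K₁ + 1) → Matrix (Fin m) (Fin m) ℝ)
    (e : Fin (K₂ + 1) → ℕ) (T : Fin (K₂ + 1) → Matrix (Fin m) (Fin m) ℝ),
    StrictMono d → StrictMono e → (∀ l, (S l).IsSymm) → (∀ l, (T l).IsSymm) →
    T 0 = S (Fin.last K₁) →
    (∀ v : Fin m → ℝ, v ≠ 0 → (S 0).mulVec v = 0 →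
        ∀ l : Fin (K₁ + 1), 0 < l → (∀ l', 0 < l' → l ≤ l') → v ⬝ᵥ (S l).mulVec v ≠ 0) →
    (∀ v : Fin m → ℝ, v ≠ 0 → (T (Fin.last K₂)).mulVec v = 0 →
        ∀ l : Fin (K₂ + 1), l < Fin.last K₂ → (∀ l', l' < Fin.last K₂ → l' ≤ l) → v ⬝ᵥ (T l).mulVec v ≠ 0) →
    (∀ v : Fin m → ℝ, v ≠ 0 → (S (Fin.last K₁)).mulVec v = 0 →
        (∀ l : Fin (K₁ + 1), l < Fin.last K₁ → (∀ l', l' < Fin.last K₁ → l' ≤ l) → v ⬝ᵥ (S l).mulVec v ≠ 0) ∧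
        (∀ l : Fin (K₂ + 1), 0 < l → (∀ l', 0 < l' → l ≤ l') → v ⬝ᵥ (T l).mulVec v ≠ 0)) →
    ∀ᶠ Λ : ℝ in atTop,
      posD (junction K₁ K₂ d S e T Λ).det ≤
        posM (pencil d S).det + posM (pencil e T).det + (m - (S (Fin.last K₁)).rank)

end Summit.ValiantsHypothesis.ValiantsHypothesis.Theorems.LacunarySymmetroidMatrixDescartes.JunctionCeiling
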